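import Summits.RiemannHypothesis.RiemannHypothesis.Theorems.WeilGroundStateGroundStatesConvergeToXiRHofTightZero
import Literature.NumberTheory.LFunctions.WeilGroundStateRealZerosProofs
import Literature.NumberTheory.LFunctions.WeilWindowSimpleEven
import HarnessLib

/-!
# `WeilGroundState.GroundStatesConvergeToXi` — spectral-gap dominance of a `Φ`-convergent
quasimode family gives C⁺ (hence the crux, hence RH)
(crux item stmt-RiemannHypothesis-1527, route route-RiemannHypothesis-WeilGroundState; line `Sketch`,
lead c3; `--supports`: the exact RH-free interface between the open stub `stub_tightWeakLimit`
(C⁺) and the two printed missing steps of Connes–Consani–Moscovici (arXiv:2511.22755 §8):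
(1) a quantitative spectral gap above the ground state, (2) a guess (`k_λ`, Connes
arXiv:2602.04022 Fact 6.4) whose energy defect is dominated by that gap)

RH-free, no new definitions.  At a window `a` let `u` be a ground state and suppose the
VARIATIONAL GAP INEQUALITY with constant `δ > 0`,
`δ · (‖g‖² − |⟨g, u⟩|²) ≤ Re Q(g) − ε(a)‖g‖²` for all window test functions `g`
(for a window where the bottom is simple, isolated and even this is PROVED in the tree from the
clause `WeilWindowSimpleEven a`: `ConnesVanSuijlekom.gap_inequality`).  Then:

* `one_sub_norm_sq_overlap_le_of_gap` — a normalised window test function `p` ("quasimode") with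
  `Re Q(p) ≤ ε(a) + θδ` has `1 − |⟨p, u⟩|² ≤ θ`, i.e. `‖p − ⟨p,u⟩u‖₂² ≤ θ`
  (`integral_norm_sq_quasimode_sub_proj_le`);
* `tightWeakLimit_of_gap_quasimode` — **the bridge**: along `a_k → ∞`, gaps `δ_k` above ground
  states `u_k` and quasimodes `p_k` with defects `≤ θ_k δ_k`, `θ_k e^{2a_k} → 0`, which after a
  bounded renormalisation `d_k p_k` are tight in every `L¹(e^{b|t|})`, `b < 1/2`, and converge
  weakly to Riemann's kernel `Φ = 2Ψ(2·)`, give C⁺ VERBATIM (with `c_k = d_k ⟨p_k, u_k⟩`);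
* `riemannHypothesis_of_gap_quasimode` — hence (C⁺ ⇒ RH, `riemannHypothesis_of_tightWeakLimit`)
  **such a gap-dominant `Φ`-quasimode family proves RH**: an RH-criterion on the truncated Weil
  form that never mentions the shape of the true ground state.
Caveat recorded for the planner (Numerics-r1-k2, CCM25 §6 table): the truncated kernel
`φ_a = Φχ_a` is NOT such a quasimode — its defect `~exp(−2πe^{2(a−1)})` exceeds the gap
`ε₂ − ε₁ ≈ 3·10⁷ ε₁ ≈ 10⁻⁴⁶` at `a = 1.24`; only a prolate-corrected guess can be.
-/

noncomputable section

set_option linter.dupNamespace false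

open scoped Topology Real ComplexConjugate
open Filter Set MeasureTheory Complex

namespace Summit.RiemannHypothesis.RiemannHypothesis.Theorems.GroundStatesConvergeToXi

open Literature.NumberTheory.LFunctions

/-! ## One window: gap + quasimode ⇒ overlap -/

/-- **Gap + quasimode ⇒ overlap.**  If the variational gap inequality with constant `δ > 0` holds
above the ground state `u` at the window `a`, then every normalised window test function `p` with
`Re Q(p) ≤ ε(a) + θδ` satisfies `1 − |⟨p, u⟩|² ≤ θ`. [folklore] -/
theorem one_sub_norm_sq_overlap_le_of_gap {a δ θ : ℝ} {u p : ℝ → ℂ}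
    (hgap : ∀ g : ℝ → ℂ, IsWeilTest g → tsupport g ⊆ Icc (-a) a →
      δ * ((∫ t, ‖g t‖ ^ 2) - ‖∫ t, g t * conj (u t)‖ ^ 2) ≤
        (weilQuadratic g).re - weilGroundEnergy a * ∫ t, ‖g t‖ ^ 2)
    (hδ : 0 < δ) (hp : IsWeilTest p) (hps : tsupport p ⊆ Icc (-a) a)
    (hp1 : ∫ t, ‖p t‖ ^ 2 = (1 : ℝ))
    (hdef : (weilQuadratic p).re ≤ weilGroundEnergy a + θ * δ) :
    1 - ‖∫ t, p t * conj (u t)‖ ^ 2 ≤ θ := by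
  have h := hgap p hp hps
  rw [hp1, mul_one] at h
  have h2 : δ * (1 - ‖∫ t, p t * conj (u t)‖ ^ 2) ≤ δ * θ := by linarith
  exact le_of_mul_le_mul_left h2 hδ

/-- **Gap + quasimode ⇒ `L²`-closeness to the ground state**: with `A = ⟨p, u⟩ = ∫ p ū`,
`∫ ‖p − A u‖² = 1 − |A|² ≤ θ`. [folklore] -/
theorem integral_norm_sq_quasimode_sub_proj_le {a δ θ : ℝ} {u p : ℝ → ℂ}
    (hu : IsWeilGroundState a u)
    (hgap : ∀ g : ℝ → ℂ, IsWeilTest g → tsupport g ⊆ Icc (-a) a →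
      δ * ((∫ t, ‖g t‖ ^ 2) - ‖∫ t, g t * conj (u t)‖ ^ 2) ≤
        (weilQuadratic g).re - weilGroundEnergy a * ∫ t, ‖g t‖ ^ 2)
    (hδ : 0 < δ) (hp : IsWeilTest p) (hps : tsupport p ⊆ Icc (-a) a)
    (hp1 : ∫ t, ‖p t‖ ^ 2 = (1 : ℝ))
    (hdef : (weilQuadratic p).re ≤ weilGroundEnergy a + θ * δ) :
    ∫ t, ‖p t + -(∫ y, p y * conj (u y)) * u t‖ ^ 2 ≤ θ := by
  rw [ConnesVanSuijlekom.integral_norm_sq_sub_proj (ConnesVanSuijlekom.isWeilTest_memLp hp)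
    hu.memLp hu.integral_norm_sq, hp1]
  exact one_sub_norm_sq_overlap_le_of_gap hgap hδ hp hps hp1 hdef

/-- With `WeilWindowSimpleEven a` (bottom simple, isolated, even — the window clause of crux #2)
the gap inequality holds for SOME `δ > 0` (`ConnesVanSuijlekom.gap_inequality`), so a normalised
window quasimode `p` with `Re Q(p) ≤ ε(a) + η` has `1 − |⟨p,u⟩|² ≤ η/δ`. [folklore] -/
theorem exists_one_sub_norm_sq_overlap_le_of_windowSimpleEven {a : ℝ} {u : ℝ → ℂ}
    (hW : WeilWindowSimpleEven a) (hu : IsWeilGroundState a u) :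
    ∃ δ : ℝ, 0 < δ ∧ ∀ p : ℝ → ℂ, IsWeilTest p → tsupport p ⊆ Icc (-a) a →
      ∫ t, ‖p t‖ ^ 2 = (1 : ℝ) → ∀ η : ℝ, (weilQuadratic p).re ≤ weilGroundEnergy a + η →
        1 - ‖∫ t, p t * conj (u t)‖ ^ 2 ≤ η / δ := by
  obtain ⟨δ, hδ, hgap⟩ := ConnesVanSuijlekom.gap_inequality hW hu
  refine ⟨δ, hδ, fun p hp hps hp1 η hdef => ?_⟩
  refine one_sub_norm_sq_overlap_le_of_gap hgap hδ hp hps hp1 ?_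
  rwa [div_mul_cancel₀ _ hδ.ne']

/-! ## Small `L²` errors on a window are negligible for tightness and weak limits -/

/-- **Weighted `L¹` mass of a small `L²` error on a window** (AM–GM, no square roots): if `w`
vanishes a.e. off `[-a, a]`, `a ≥ 0`, `∫‖w‖² ≤ θ` and `|b| ≤ 1/2`, then for every `s > 0`,
`∫ ‖w‖ e^{b|t|} ≤ θ/(2s) + s · a · e^{a}`. [folklore] -/
theorem integral_norm_mul_exp_le_of_sq_le {a θ b s : ℝ} {w : ℝ → ℂ} (hw : MemLp w 2)
    (hw0 : ∀ᵐ t : ℝ, t ∉ Icc (-a) a → w t = 0) (ha : 0 ≤ a)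
    (hθ : ∫ t, ‖w t‖ ^ 2 ≤ θ) (hb : |b| ≤ 1 / 2) (hs : 0 < s) :
    ∫ t, ‖w t‖ * Real.exp (b * |t|) ≤ θ / (2 * s) + s * a * Real.exp a := by
  have hw2 : Integrable fun t => ‖w t‖ ^ 2 := (memLp_two_iff_integrable_sq_norm hw.1).1 hw
  have hind : IntegrableOn (fun _ : ℝ => (1 : ℝ)) (Icc (-a) a) := by
    rw [integrableOn_const_iff]; right; exact measure_Icc_lt_top
  set χ : ℝ → ℝ := (Icc (-a) a).indicator fun _ => (1 : ℝ) with hχ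
  have hχi : Integrable χ := hind.integrable_indicator measurableSet_Icc
  have hmaj : Integrable fun t => ‖w t‖ ^ 2 / (2 * s) + s / 2 * Real.exp a * χ t :=
    (hw2.div_const _).add (hχi.const_mul _)
  -- pointwise AM–GM on the window, `0 = 0` off it
  have hpt : ∀ᵐ t : ℝ, ‖w t‖ * Real.exp (b * |t|) ≤ ‖w t‖ ^ 2 / (2 * s) + s / 2 * Real.exp a * χ t := by
    filter_upwards [hw0] with t ht
    by_cases hm : t ∈ Icc (-a) a
    · have hχ1 : χ t = 1 := by simp [hχ, hm]
      rw [hχ1, mul_one]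
      have hta : |t| ≤ a := abs_le.2 ⟨hm.1, hm.2⟩
      have he : Real.exp (b * |t|) ≤ Real.exp a := Real.exp_le_exp.2 (by
        have : b * |t| ≤ |b| * |t| := mul_le_mul_of_nonneg_right (le_abs_self b) (abs_nonneg t)
        nlinarith [abs_nonneg t, abs_nonneg b])
      have he0 : 0 < Real.exp (b * |t|) := Real.exp_pos _
      have h1 : ‖w t‖ * Real.exp (b * |t|) ≤ ‖w t‖ ^ 2 / (2 * s) + s / 2 * Real.exp (b * |t|) ^ 2 := by
        have h := sq_nonneg (‖w t‖ - s * Real.exp (b * |t|))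
        have e : ‖w t‖ ^ 2 / (2 * s) + s / 2 * Real.exp (b * |t|) ^ 2 - ‖w t‖ * Real.exp (b * |t|) =
            (‖w t‖ - s * Real.exp (b * |t|)) ^ 2 / (2 * s) := by
          field_simp
          ring
        have : 0 ≤ (‖w t‖ - s * Real.exp (b * |t|)) ^ 2 / (2 * s) := by positivity
        linarith
      have h2 : Real.exp (b * |t|) ^ 2 ≤ Real.exp a := by
        have h3 : Real.exp (b * |t|) ^ 2 = Real.exp (2 * (b * |t|)) := by
          rw [← Real.exp_nat_mul]; norm_num
        rw [h3]
        refine Real.exp_le_exp.2 ?_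
        have : b * |t| ≤ |b| * |t| := mul_le_mul_of_nonneg_right (le_abs_self b) (abs_nonneg t)
        nlinarith [abs_nonneg t, abs_nonneg b]
      have hs2 : 0 ≤ s / 2 := by positivity
      nlinarith [mul_le_mul_of_nonneg_left h2 hs2]
    · simp [ht hm, hχ, hm]
  calc ∫ t, ‖w t‖ * Real.exp (b * |t|)
      ≤ ∫ t, (‖w t‖ ^ 2 / (2 * s) + s / 2 * Real.exp a * χ t) :=
        integral_mono_of_nonneg (ae_of_all _ fun t => by positivity) hmaj hpt
    _ = (∫ t, ‖w t‖ ^ 2) / (2 * s) + s / 2 * Real.exp a * ∫ t, χ t := by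
        rw [integral_add (hw2.div_const _) (hχi.const_mul _), integral_div, integral_const_mul]
    _ = (∫ t, ‖w t‖ ^ 2) / (2 * s) + s / 2 * Real.exp a * (2 * a) := by
        rw [hχ, integral_indicator measurableSet_Icc, setIntegral_const, measureReal_def,
          Real.volume_Icc, ENNReal.toReal_ofReal (by linarith)]
        simp only [smul_eq_mul, mul_one]
        ring
    _ ≤ θ / (2 * s) + s * a * Real.exp a := by
        have h1 : (∫ t, ‖w t‖ ^ 2) / (2 * s) ≤ θ / (2 * s) :=
          div_le_div_of_nonneg_right hθ (by positivity)
        nlinarith [Real.exp_pos a]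

/-- **Weighted `L¹` mass of a small `L²` error, scale-free form**: under the same hypotheses with
`a ≥ 0`, `∫ ‖w‖ e^{b|t|} ≤ 2 (√θ · e^{a}) + 1` (choose `s = (√θ + e^{−a})e^{−a}`). [folklore] -/
theorem integral_norm_mul_exp_le_sqrt {a θ b : ℝ} {w : ℝ → ℂ} (hw : MemLp w 2)
    (hw0 : ∀ᵐ t : ℝ, t ∉ Icc (-a) a → w t = 0) (ha : 0 ≤ a) (hθ0 : 0 ≤ θ)
    (hθ : ∫ t, ‖w t‖ ^ 2 ≤ θ) (hb : |b| ≤ 1 / 2) :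
    ∫ t, ‖w t‖ * Real.exp (b * |t|) ≤ 2 * (Real.sqrt θ * Real.exp a) + 1 := by
  set s : ℝ := (Real.sqrt θ + Real.exp (-a)) * Real.exp (-a) with hsdef
  have hs : 0 < s := by positivity
  have h := integral_norm_mul_exp_le_of_sq_le hw hw0 ha hθ hb hs
  have hea : Real.exp a * Real.exp (-a) = 1 := by rw [← Real.exp_add, add_neg_cancel, Real.exp_zero]
  have hsq : Real.sqrt θ * Real.sqrt θ = θ := Real.mul_self_sqrt hθ0
  -- `θ/(2s) ≤ √θ e^{a} / 2`
  have h1 : θ / (2 * s) ≤ Real.sqrt θ * Real.exp a / 2 := by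
    rw [div_le_div_iff₀ (by positivity) (by norm_num : (0 : ℝ) < 2), hsdef]
    have h2 : 0 ≤ Real.sqrt θ * Real.exp (-a) := by positivity
    nlinarith [Real.sqrt_nonneg θ, Real.exp_pos a, Real.exp_pos (-a)]
  -- `s a e^{a} = (√θ + e^{-a}) a ≤ √θ e^{a} + 1`
  have h3 : s * a * Real.exp a ≤ Real.sqrt θ * Real.exp a + 1 := by
    have e : s * a * Real.exp a = (Real.sqrt θ + Real.exp (-a)) * a := by
      rw [hsdef, show (Real.sqrt θ + Real.exp (-a)) * Real.exp (-a) * a * Real.exp a =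
        (Real.sqrt θ + Real.exp (-a)) * a * (Real.exp a * Real.exp (-a)) by ring, hea, mul_one]
    rw [e]
    have h4 : a ≤ Real.exp a := by linarith [Real.add_one_le_exp a]
    have h5 : Real.exp (-a) * a ≤ 1 := by
      have := mul_le_mul_of_nonneg_left h4 (Real.exp_pos (-a)).le
      rw [mul_comm (Real.exp (-a)) (Real.exp a), hea] at this
      exact this
    nlinarith [Real.sqrt_nonneg θ, mul_le_mul_of_nonneg_left h4 (Real.sqrt_nonneg θ)]
  have hX : 0 ≤ Real.sqrt θ * Real.exp a := by positivity
  linarith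

/-- **Pairing a small `L²` error with a test function** (Cauchy–Schwarz):
`‖∫ w g‖ ≤ √(∫‖w‖²) · √(∫‖g‖²)`. [folklore] -/
theorem norm_integral_mul_le_sqrt_mul_sqrt {w g : ℝ → ℂ} (hw : MemLp w 2) (hg : MemLp g 2) :
    ‖∫ t, w t * g t‖ ≤ Real.sqrt (∫ t, ‖w t‖ ^ 2) * Real.sqrt (∫ t, ‖g t‖ ^ 2) := by
  have h := ConnesVanSuijlekom.norm_integral_mul_conj_sub_le hw
    (ConnesVanSuijlekom.memLp_conj hg) (MemLp.zero' : MemLp (fun _ : ℝ => (0 : ℂ)) 2)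
  have e1 : (fun t => w t * conj (conj (g t))) = fun t => w t * g t := by
    funext t; rw [Complex.conj_conj]
  simp only [map_zero, mul_zero, integral_zero, sub_zero, Complex.conj_conj,
    Complex.norm_conj] at h
  exact h

/-! ## The bridge: gap-dominant `Φ`-quasimodes ⇒ C⁺ ⇒ RH -/

/-- **THE BRIDGE (RH-free): spectral-gap dominance of a `Φ`-convergent quasimode family gives
C⁺.**  Let `a_k → ∞`, `u_k` ground states at `a_k`, and suppose:
(GAP) the variational gap inequality above `u_k` with constant `δ_k > 0`;
(QM) normalised window test functions `p_k` with `Re Q(p_k) ≤ ε(a_k) + θ_k δ_k`, `0 ≤ θ_k < 1`,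
  `θ_k e^{2a_k} → 0`;
(Φ) scalars `d_k ≠ 0`, `‖d_k‖ ≤ D`, such that `d_k p_k` is tight in every `L¹(e^{b|t|})`, `b < 1/2`,
  and `∫ d_k p_k g → ∫ Φ g` for every test function `g`.
Then C⁺ holds verbatim with the SAME ground states and `c_k := d_k ⟨p_k, u_k⟩`:
`‖p_k − ⟨p_k,u_k⟩u_k‖₂² ≤ θ_k` (gap + quasimode), and an `L²`-error `√θ_k` on a window of
radius `a_k` costs at most `2√θ_k e^{a_k} + 1` in every `L¹(e^{b|t|})`, `|b| ≤ 1/2`, and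
`√θ_k ‖g‖₂` against a test function.  This is the exact interface for CCM25 §8 (steps 1–2) /
Connes' Fact 6.4: feed it a prolate-corrected guess `p_k = k_λ/‖k_λ‖`. [folklore] -/
theorem tightWeakLimit_of_gap_quasimode {a : ℕ → ℝ} {u p : ℕ → ℝ → ℂ} {d : ℕ → ℂ}
    {δ θ : ℕ → ℝ}
    (ha : Tendsto a atTop atTop) (hu : ∀ k, IsWeilGroundState (a k) (u k))
    (hgap : ∀ k, ∀ g : ℝ → ℂ, IsWeilTest g → tsupport g ⊆ Icc (-(a k)) (a k) →
      δ k * ((∫ t, ‖g t‖ ^ 2) - ‖∫ t, g t * conj (u k t)‖ ^ 2) ≤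
        (weilQuadratic g).re - weilGroundEnergy (a k) * ∫ t, ‖g t‖ ^ 2)
    (hδ : ∀ k, 0 < δ k)
    (hp : ∀ k, IsWeilTest (p k) ∧ tsupport (p k) ⊆ Icc (-(a k)) (a k) ∧
      ∫ t, ‖p k t‖ ^ 2 = (1 : ℝ))
    (hdef : ∀ k, (weilQuadratic (p k)).re ≤ weilGroundEnergy (a k) + θ k * δ k)
    (hθ0 : ∀ k, 0 ≤ θ k) (hθ1 : ∀ k, θ k < 1)
    (hθ : Tendsto (fun k => θ k * Real.exp (2 * a k)) atTop (𝓝 0))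
    (hd0 : ∀ k, d k ≠ 0) (hdD : ∃ D : ℝ, ∀ k, ‖d k‖ ≤ D)
    (hptight : ∀ b : ℝ, b < 1 / 2 → ∃ M : ℝ, ∀ k, ∫ t, ‖d k * p k t‖ * Real.exp (b * |t|) ≤ M)
    (hpweak : ∀ g : ℝ → ℂ, IsWeilTest g →
      Tendsto (fun k => ∫ t, d k * p k t * g t) atTop
        (𝓝 (∫ t, 2 * LagariasMontague.Psic (2 * t) * g t))) :
    ∃ a : ℕ → ℝ, ∃ u : ℕ → ℝ → ℂ, ∃ c : ℕ → ℂ, Tendsto a atTop atTop ∧ (∀ k, c k ≠ 0) ∧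
      (∀ k, IsWeilGroundState (a k) (u k)) ∧
      (∀ b : ℝ, b < 1 / 2 → ∃ M : ℝ, ∀ k, ∫ t, ‖c k * u k t‖ * Real.exp (b * |t|) ≤ M) ∧
      (∀ g : ℝ → ℂ, IsWeilTest g →
        Tendsto (fun k => ∫ t, c k * u k t * g t) atTop
          (𝓝 (∫ t, 2 * LagariasMontague.Psic (2 * t) * g t))) := by
  obtain ⟨D, hD⟩ := hdD
  have hD0 : 0 ≤ D := (norm_nonneg _).trans (hD 0)
  -- the overlaps `A k = ⟨p_k, u_k⟩` and the `L²` errors `w k = p_k − A_k u_k`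
  set A : ℕ → ℂ := fun k => ∫ t, p k t * conj (u k t) with hAdef
  have hA : ∀ k, 1 - θ k ≤ ‖A k‖ ^ 2 := fun k => by
    have := one_sub_norm_sq_overlap_le_of_gap (hgap k) (hδ k) (hp k).1 (hp k).2.1 (hp k).2.2 (hdef k)
    simp only [hAdef]; linarith
  have hA0 : ∀ k, A k ≠ 0 := fun k h0 => by
    have h1 := hA k
    rw [h0, norm_zero] at h1
    linarith [hθ1 k]
  set w : ℕ → ℝ → ℂ := fun k t => p k t + -(A k) * u k t with hwdef
  have hwL : ∀ k, MemLp (w k) 2 := fun k =>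
    (ConnesVanSuijlekom.isWeilTest_memLp (hp k).1).add ((hu k).memLp.const_mul _)
  have hw2 : ∀ k, ∫ t, ‖w k t‖ ^ 2 ≤ θ k := fun k =>
    integral_norm_sq_quasimode_sub_proj_le (hu k) (hgap k) (hδ k) (hp k).1 (hp k).2.1 (hp k).2.2 (hdef k)
  have hw0 : ∀ k, ∀ᵐ t : ℝ, t ∉ Icc (-(a k)) (a k) → w k t = 0 := fun k => by
    filter_upwards [(hu k).ae_eq_zero_of_notMem] with t ht hm
    have hp0 : p k t = 0 := image_eq_zero_of_notMem_tsupport fun h' => hm ((hp k).2.1 h')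
    simp [hwdef, hp0, ht hm]
  -- the renormalisation: `c_k u_k = d_k p_k − d_k w_k`
  have hcu : ∀ k t, d k * A k * u k t = d k * p k t - d k * w k t := fun k t => by
    simp only [hwdef]; ring
  -- `θ_k e^{2a_k}` is bounded and `θ_k → 0`
  obtain ⟨T, hT⟩ := hθ.bddAbove_range
  have hT' : ∀ k, θ k * Real.exp (2 * a k) ≤ T := fun k => hT ⟨k, rfl⟩
  have hT0 : 0 ≤ T := (mul_nonneg (hθ0 0) (Real.exp_pos _).le).trans (hT' 0)
  have hsqrt : ∀ k, Real.sqrt (θ k) * Real.exp (a k) ≤ Real.sqrt T := fun k => by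
    have e : Real.sqrt (θ k) * Real.exp (a k) = Real.sqrt (θ k * Real.exp (2 * a k)) := by
      rw [Real.sqrt_mul (hθ0 k), show (2 : ℝ) * a k = a k + a k by ring, Real.exp_add,
        Real.sqrt_mul_self (Real.exp_pos _).le]
    rw [e]
    exact Real.sqrt_le_sqrt (hT' k)
  have hθt : Tendsto θ atTop (𝓝 0) := by
    refine tendsto_of_tendsto_of_tendsto_of_le_of_le' tendsto_const_nhds hθ
      (Eventually.of_forall hθ0) ?_
    filter_upwards [ha.eventually (eventually_ge_atTop (0 : ℝ))] with k hk
    exact le_mul_of_one_le_right (hθ0 k) (Real.one_le_exp (by positivity))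
  refine ⟨a, u, fun k => d k * A k, ha, fun k => mul_ne_zero (hd0 k) (hA0 k), hu, ?_, ?_⟩
  · -- tightness
    intro b hb
    set b' : ℝ := max b (-(1 / 2)) with hb'def
    have hb'1 : |b'| ≤ 1 / 2 := abs_le.2 ⟨le_max_right _ _, max_le hb.le (by norm_num)⟩
    have hb'2 : b' < 1 / 2 := max_lt hb (by norm_num)
    have hbb' : b ≤ b' := le_max_left _ _
    obtain ⟨M, hM⟩ := hptight b' hb'2
    refine ⟨M + D * (2 * Real.sqrt T + 1), fun k => ?_⟩
    have hak : 0 ≤ a k := (hu k).pos.le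
    -- integrability of the three weighted functions
    have hi_cu := stub_pointwise_of_weak_integrable_weight (hu k) (d k * A k) b'
    have hi_p : Integrable fun t => ‖d k * p k t‖ * Real.exp (b' * |t|) :=
      ((((hp k).1.const_mul (d k)).1.continuous.norm).mul (by fun_prop)).integrable_of_hasCompactSupport
        (((hp k).1.2.mul_left (f := fun _ => d k)).norm.mul_right)
    have hi_w : Integrable fun t => ‖w k t‖ * Real.exp (b' * |t|) := by
      have h1 : Integrable fun t => ‖p k t‖ * Real.exp (b' * |t|) :=
        (((hp k).1.1.continuous.norm).mul (by fun_prop)).integrable_of_hasCompactSupport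
          ((hp k).1.2.norm.mul_right)
      have h2 := stub_pointwise_of_weak_integrable_weight (hu k) (-(A k)) b'
      have h12 : Integrable fun t => ‖p k t‖ * Real.exp (b' * |t|) +
          ‖-(A k) * u k t‖ * Real.exp (b' * |t|) := h1.add h2
      refine h12.mono' ((hwL k).1.norm.mul (by fun_prop)) (ae_of_all _ fun t => ?_)
      rw [Real.norm_eq_abs, abs_of_nonneg (by positivity)]
      have he : 0 ≤ Real.exp (b' * |t|) := (Real.exp_pos _).le
      calc ‖w k t‖ * Real.exp (b' * |t|) ≤ (‖p k t‖ + ‖-(A k) * u k t‖) * Real.exp (b' * |t|) :=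
            mul_le_mul_of_nonneg_right (norm_add_le _ _) he
        _ = ‖p k t‖ * Real.exp (b' * |t|) + ‖-(A k) * u k t‖ * Real.exp (b' * |t|) := by ring
    -- pointwise comparison and the two bounds
    calc ∫ t, ‖d k * A k * u k t‖ * Real.exp (b * |t|)
        ≤ ∫ t, (‖d k * p k t‖ * Real.exp (b' * |t|) + ‖d k‖ * (‖w k t‖ * Real.exp (b' * |t|))) := by
          refine integral_mono_of_nonneg (ae_of_all _ fun t => by positivity)
            (hi_p.add (hi_w.const_mul _)) (ae_of_all _ fun t => ?_)
          have h1 : Real.exp (b * |t|) ≤ Real.exp (b' * |t|) :=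
            Real.exp_le_exp.2 (mul_le_mul_of_nonneg_right hbb' (abs_nonneg t))
          have h2 : ‖d k * A k * u k t‖ ≤ ‖d k * p k t‖ + ‖d k‖ * ‖w k t‖ := by
            rw [hcu k t, ← norm_mul]
            exact norm_sub_le _ _
          have h3 := mul_le_mul h2 h1 (Real.exp_pos _).le (by positivity)
          nlinarith [norm_nonneg (d k * p k t), norm_nonneg (d k), norm_nonneg (w k t),
            Real.exp_pos (b' * |t|)]
      _ = (∫ t, ‖d k * p k t‖ * Real.exp (b' * |t|)) + ‖d k‖ * ∫ t, ‖w k t‖ * Real.exp (b' * |t|) := by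
          rw [integral_add hi_p (hi_w.const_mul _), integral_const_mul]
      _ ≤ M + D * (2 * Real.sqrt T + 1) := by
          have h1 := hM k
          have h2 := integral_norm_mul_exp_le_sqrt (hwL k) (hw0 k) hak (hθ0 k) (hw2 k) hb'1
          have h3 : ∫ t, ‖w k t‖ * Real.exp (b' * |t|) ≤ 2 * Real.sqrt T + 1 := by
            linarith [hsqrt k]
          have h4 : 0 ≤ ∫ t, ‖w k t‖ * Real.exp (b' * |t|) := integral_nonneg fun _ => by positivity
          nlinarith [hD k, norm_nonneg (d k)]
  · -- weak convergence
    intro g hg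
    have hgL := ConnesVanSuijlekom.isWeilTest_memLp hg
    have hsplit : ∀ k, ∫ t, d k * A k * u k t * g t =
        (∫ t, d k * p k t * g t) - d k * ∫ t, w k t * g t := by
      intro k
      have hi1 : Integrable fun t => d k * p k t * g t :=
        ((((hp k).1.const_mul (d k)).1.continuous).mul hg.1.continuous).integrable_of_hasCompactSupport
          (hg.2.mul_left)
      have hi2 : Integrable fun t => w k t * g t := (hwL k).integrable_mul hgL
      rw [show d k * ∫ t, w k t * g t = ∫ t, d k * (w k t * g t) from (integral_const_mul _ _).symm,
        ← integral_sub hi1 (hi2.const_mul _)]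
      refine integral_congr_ae (ae_of_all _ fun t => ?_)
      simp only [hcu k t]
      ring
    simp_rw [hsplit]
    rw [← sub_zero (∫ t, 2 * LagariasMontague.Psic (2 * t) * g t)]
    refine (hpweak g hg).sub ?_
    -- `d_k ∫ w_k g → 0`
    refine squeeze_zero_norm (fun k => ?_)
      (by simpa using ((hθt.sqrt).const_mul (D * Real.sqrt (∫ t, ‖g t‖ ^ 2))))
    rw [norm_mul]
    have h1 := norm_integral_mul_le_sqrt_mul_sqrt (hwL k) hgL
    have h2 : Real.sqrt (∫ t, ‖w k t‖ ^ 2) ≤ Real.sqrt (θ k) := Real.sqrt_le_sqrt (hw2 k)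
    have h3 : 0 ≤ Real.sqrt (∫ t, ‖g t‖ ^ 2) := Real.sqrt_nonneg _
    calc ‖d k‖ * ‖∫ t, w k t * g t‖ ≤ D * (Real.sqrt (θ k) * Real.sqrt (∫ t, ‖g t‖ ^ 2)) :=
          mul_le_mul (hD k) (h1.trans (mul_le_mul_of_nonneg_right h2 h3)) (norm_nonneg _) hD0
      _ = D * Real.sqrt (∫ t, ‖g t‖ ^ 2) * Real.sqrt (θ k) := by ring

/-- **RH from a gap-dominant `Φ`-quasimode family** (the bridge composed with C⁺ ⇒ RH,
`riemannHypothesis_of_tightWeakLimit`): if along windows `a_k → ∞` the truncated Weil form has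
gaps `δ_k` above its ground states (e.g. from `WeilWindowSimpleEven (a_k)` via
`ConnesVanSuijlekom.gap_inequality`) and admits normalised quasimodes `p_k` with defects
`≤ θ_k δ_k`, `θ_k e^{2a_k} → 0`, whose bounded renormalisations `d_k p_k` are tight in every
`L¹(e^{b|t|})`, `b < 1/2`, and converge weakly to `Φ = 2Ψ(2·)`, then the Riemann Hypothesis holds.
An RH-criterion on the truncated Weil form alone; the shape of the true ground state never enters.
[folklore] -/
theorem riemannHypothesis_of_gap_quasimode {a : ℕ → ℝ} {u p : ℕ → ℝ → ℂ} {d : ℕ → ℂ}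
    {δ θ : ℕ → ℝ}
    (ha : Tendsto a atTop atTop) (hu : ∀ k, IsWeilGroundState (a k) (u k))
    (hgap : ∀ k, ∀ g : ℝ → ℂ, IsWeilTest g → tsupport g ⊆ Icc (-(a k)) (a k) →
      δ k * ((∫ t, ‖g t‖ ^ 2) - ‖∫ t, g t * conj (u k t)‖ ^ 2) ≤
        (weilQuadratic g).re - weilGroundEnergy (a k) * ∫ t, ‖g t‖ ^ 2)
    (hδ : ∀ k, 0 < δ k)
    (hp : ∀ k, IsWeilTest (p k) ∧ tsupport (p k) ⊆ Icc (-(a k)) (a k) ∧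
      ∫ t, ‖p k t‖ ^ 2 = (1 : ℝ))
    (hdef : ∀ k, (weilQuadratic (p k)).re ≤ weilGroundEnergy (a k) + θ k * δ k)
    (hθ0 : ∀ k, 0 ≤ θ k) (hθ1 : ∀ k, θ k < 1)
    (hθ : Tendsto (fun k => θ k * Real.exp (2 * a k)) atTop (𝓝 0))
    (hd0 : ∀ k, d k ≠ 0) (hdD : ∃ D : ℝ, ∀ k, ‖d k‖ ≤ D)
    (hptight : ∀ b : ℝ, b < 1 / 2 → ∃ M : ℝ, ∀ k, ∫ t, ‖d k * p k t‖ * Real.exp (b * |t|) ≤ M)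
    (hpweak : ∀ g : ℝ → ℂ, IsWeilTest g →
      Tendsto (fun k => ∫ t, d k * p k t * g t) atTop
        (𝓝 (∫ t, 2 * LagariasMontague.Psic (2 * t) * g t))) :
    RiemannHypothesis :=
  riemannHypothesis_of_tightWeakLimit
    (tightWeakLimit_of_gap_quasimode ha hu hgap hδ hp hdef hθ0 hθ1 hθ hd0 hdD hptight hpweak)

end Summit.RiemannHypothesis.RiemannHypothesis.Theorems.GroundStatesConvergeToXi

end
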